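import Mathlib
import Literature.RepresentationTheory.FiniteGroups.IrreducibleCharacters

/-!
# Stub `stub_prodBudget` of line `Sketch` (crux `stmt-MatrixMultiplication-7610`,
# `LevelGradedCohnUmans.GradedDesignFamily`): the graded budget of a binary product

For finite groups `K`, `L`, subspaces `J_K ≤ ℂ^K`, `J_L ≤ ℂ^L` (no invariance assumed) and the
external product space `J_K ⊠ J_L = span{(k, l) ↦ f k * g l : f ∈ J_K, g ∈ J_L}`, the graded budget
`Σᶠ_{χ ∈ Irr(K × L) ∩ (J_K ⊠ J_L)} χ(1)^s` is at most the product of the graded budgets of `J_K` and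
`J_L`, for every real exponent `s`.

Proof: (a) a character `χ` with `⟨χ, χ⟩ = 1` is irreducible, so the external product `ψ ⊠ φ` of
irreducible characters is an irreducible character of `K × L` (it is the character of the tensor
product of the inflated representations, and `⟨ψ ⊠ φ, ψ ⊠ φ⟩ = ⟨ψ, ψ⟩ ⟨φ, φ⟩ = 1`);
(c) completeness: the regular character of `K × L` is `r_K ⊠ r_L = Σ_{ψ, φ} ψ(1) φ(1) · ψ ⊠ φ`, and
every irreducible `χ` has `⟨r_{K×L}, χ⟩ = χ(1) ≠ 0`, so `χ` is not orthogonal to, hence equal to,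
some `ψ ⊠ φ`; (d) if `ψ ⊠ φ ∈ J_K ⊠ J_L` then averaging against `φ(l⁻¹)` over `L` (a linear map
sending `f ⊠ g` to a multiple of `f`) gives `|L| · ψ ∈ J_K`; (e) the budget of `J_K ⊠ J_L` is thus
a sub-sum of `Σ_{(ψ, φ)} ψ(1)^s φ(1)^s` over `(Irr K ∩ J_K) × (Irr L ∩ J_L)`.
-/

noncomputable section

set_option linter.dupNamespace false

open scoped BigOperators
open Literature.RepresentationTheory.FiniteGroups

namespace Summit.MatrixMultiplication.MatrixMultiplication.Theorems.GradedDesignFamily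

/-! ## (a) External products of irreducible characters are irreducible characters -/

/-- A character `χ` with `⟨χ, χ⟩ = 1` is irreducible: writing `χ = Σ_{χ' ∈ m} χ'` with irreducible
`χ'`, `⟨χ, χ⟩ = Σ_{χ' ∈ m} (multiplicity of χ')` is a sum of `card m` positive integers.
[cite: SerreLinearRepresentations1977, §2.3 Thm. 5] -/
theorem prodBudget_isIrrChar_of_classInner_eq_one {G : Type} [Group G] [Fintype G] {χ : G → ℂ}
    (hχ : IsCharacter G χ) (h1 : classInner χ χ = 1) : IsIrrChar G χ := by
  classical
  obtain ⟨m, hm, rfl⟩ := hχ.exists_multiset_irrChars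
  have hsum : ((m.map fun χ' => m.count χ').sum : ℂ) = classInner m.sum m.sum := by
    rw [classInner_multiset_sum_left, Nat.cast_multiset_sum, Multiset.map_map]
    congr 1
    refine Multiset.map_congr rfl fun χ' hχ' => ?_
    rw [Function.comp_apply, classInner_comm, classInner_multiset_sum_irrChars hm (hm χ' hχ')]
  rw [h1] at hsum
  have hnat : (m.map fun χ' => m.count χ').sum = 1 := by exact_mod_cast hsum
  have hcard : m.card ≤ 1 := by
    calc m.card = (m.map fun _ => 1).sum := by simp
      _ ≤ (m.map fun χ' => m.count χ').sum :=
          Multiset.sum_map_le_sum_map _ _ fun χ' h => Multiset.one_le_count_iff_mem.mpr h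
      _ = 1 := hnat
  have hne : m ≠ 0 := by
    rintro rfl
    simp at hnat
  obtain ⟨χ₀, rfl⟩ := Multiset.card_eq_one.mp (le_antisymm hcard (Multiset.card_pos.mpr hne))
  rw [Multiset.sum_singleton]
  exact hm χ₀ (Multiset.mem_singleton_self χ₀)

/-- An irreducible character does not vanish at `1` (its degree is the dimension of a non-zero
space). [folklore] -/
theorem prodBudget_apply_one_ne_zero {G : Type} [Group G] {χ : G → ℂ} (h : IsIrrChar G χ) :
    χ 1 ≠ 0 := by
  -- adapted from `GradedPricing.Negative.LoadBearing.apply_one_ne_zero`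
  obtain ⟨V, _, _, _, ρ, hρ, rfl⟩ := h
  haveI := hρ
  haveI : Nontrivial V := by
    by_contra hV
    rw [not_nontrivial_iff_subsingleton] at hV
    have hbt : (⊥ : Subrepresentation ρ) = ⊤ :=
      Subrepresentation.toSubmodule_injective (Subsingleton.elim _ _)
    exact (IsSimpleOrder.bot_ne_top (α := Subrepresentation ρ)) hbt
  rw [Representation.char_one]
  exact Nat.cast_ne_zero.mpr Module.finrank_pos.ne'

/-- The degree of an irreducible character is a non-negative real number. [folklore] -/
theorem prodBudget_re_apply_one_nonneg {G : Type} [Group G] {χ : G → ℂ} (h : IsIrrChar G χ) :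
    0 ≤ (χ 1).re := by
  obtain ⟨d, -, hd⟩ := h.exists_apply_one
  rw [hd, Complex.natCast_re]
  exact Nat.cast_nonneg d

/-- The external product `ψ ⊠ φ : (k, l) ↦ ψ k * φ l` of characters is a character of `K × L`
(of the tensor product of the inflated representations, `Representation.char_tensor`).
[cite: SerreLinearRepresentations1977, §3.2 Thm. 10] -/
theorem prodBudget_isCharacter_boxTimes {K L : Type} [Group K] [Group L] {ψ : K → ℂ} {φ : L → ℂ}
    (hψ : IsCharacter K ψ) (hφ : IsCharacter L φ) :
    IsCharacter (K × L) (fun p => ψ p.1 * φ p.2) := by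
  obtain ⟨V, _, _, _, ρ, rfl⟩ := hψ
  obtain ⟨W, _, _, _, σ, rfl⟩ := hφ
  refine ⟨TensorProduct ℂ V W, inferInstance, inferInstance, inferInstance,
    Representation.tprod (ρ.comp (MonoidHom.fst K L)) (σ.comp (MonoidHom.snd K L)), ?_⟩
  rw [Representation.char_tensor]
  funext p
  rfl

/-- `⟨ψ ⊠ φ, ψ' ⊠ φ'⟩_{K × L} = ⟨ψ, ψ'⟩_K ⟨φ, φ'⟩_L`. [folklore] -/
theorem prodBudget_classInner_boxTimes {K L : Type} [Group K] [Fintype K] [Group L] [Fintype L]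
    (ψ ψ' : K → ℂ) (φ φ' : L → ℂ) :
    classInner (fun p : K × L => ψ p.1 * φ p.2) (fun p => ψ' p.1 * φ' p.2) =
      classInner ψ ψ' * classInner φ φ' := by
  simp only [classInner_apply]
  rw [Fintype.card_prod, Nat.cast_mul, mul_inv, Fintype.sum_prod_type, mul_mul_mul_comm,
    Finset.sum_mul_sum]
  congr 1
  refine Finset.sum_congr rfl fun k _ => Finset.sum_congr rfl fun l _ => ?_
  simp only [Prod.inv_mk]
  ring

/-- **The external product of irreducible characters is an irreducible character of `K × L`**
(`⟨ψ ⊠ φ, ψ ⊠ φ⟩ = 1`). [cite: SerreLinearRepresentations1977, §3.2 Thm. 10] -/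
theorem prodBudget_isIrrChar_boxTimes {K L : Type} [Group K] [Fintype K] [Group L] [Fintype L]
    {ψ : K → ℂ} {φ : L → ℂ} (hψ : IsIrrChar K ψ) (hφ : IsIrrChar L φ) :
    IsIrrChar (K × L) (fun p => ψ p.1 * φ p.2) := by
  refine prodBudget_isIrrChar_of_classInner_eq_one
    (prodBudget_isCharacter_boxTimes hψ.isCharacter hφ.isCharacter) ?_
  rw [prodBudget_classInner_boxTimes, hψ.classInner_eq hψ, hφ.classInner_eq hφ, if_pos rfl,
    if_pos rfl, mul_one]

/-! ## (c) Completeness: every irreducible character of `K × L` is an external product -/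

/-- The regular character is `Σ_{ψ irreducible} ψ(1) ψ`. [cite: SerreLinearRepresentations1977, §2.4 Cor. 1] -/
theorem prodBudget_leftRegular_eq_sum {G : Type} [Group G] [Fintype G] :
    (Representation.leftRegular ℂ G).character =
      ∑ ψ ∈ (irrChars_finite_holds G).toFinset, ψ 1 • ψ := by
  refine ((isCharacter_leftRegular (G := G)).isClassFun.eq_sum_classInner_smul).trans ?_
  exact Finset.sum_congr rfl fun ψ _ => by rw [classInner_leftRegular]

/-- The regular character of `K × L` is the external product of the regular characters. [folklore] -/
theorem prodBudget_leftRegular_prod {K L : Type} [Group K] [Fintype K] [Group L] [Fintype L]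
    (p : K × L) :
    (Representation.leftRegular ℂ (K × L)).character p =
      (Representation.leftRegular ℂ K).character p.1 *
        (Representation.leftRegular ℂ L).character p.2 := by
  classical
  obtain ⟨k, l⟩ := p
  rw [character_leftRegular, character_leftRegular, character_leftRegular, Fintype.card_prod,
    Nat.cast_mul]
  simp only [Prod.mk_eq_one]
  by_cases hk : k = 1 <;> by_cases hl : l = 1 <;> simp [hk, hl]

/-- **Every irreducible character of `K × L` is an external product `ψ ⊠ φ`** of irreducible
characters: `χ(1) = ⟨r_{K × L}, χ⟩ = Σ_{ψ, φ} ψ(1) φ(1) ⟨ψ ⊠ φ, χ⟩` would vanish otherwise, by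
orthonormality. [cite: SerreLinearRepresentations1977, §3.2 Thm. 10] -/
theorem prodBudget_exists_eq_boxTimes {K L : Type} [Group K] [Fintype K] [Group L] [Fintype L]
    {χ : K × L → ℂ} (hχ : IsIrrChar (K × L) χ) :
    ∃ ψ ∈ irrChars K, ∃ φ ∈ irrChars L, χ = fun p => ψ p.1 * φ p.2 := by
  classical
  by_contra hne
  apply prodBudget_apply_one_ne_zero hχ
  rw [← classInner_leftRegular χ]
  have hreg : (Representation.leftRegular ℂ (K × L)).character =
      ∑ ψ ∈ (irrChars_finite_holds K).toFinset, ∑ φ ∈ (irrChars_finite_holds L).toFinset,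
        (ψ 1 * φ 1) • fun p : K × L => ψ p.1 * φ p.2 := by
    funext p
    rw [prodBudget_leftRegular_prod, prodBudget_leftRegular_eq_sum,
      prodBudget_leftRegular_eq_sum]
    simp only [Finset.sum_apply, Pi.smul_apply, smul_eq_mul, Finset.sum_mul_sum]
    refine Finset.sum_congr rfl fun ψ _ => Finset.sum_congr rfl fun φ _ => ?_
    ring
  rw [hreg, classInner_sum_left]
  refine Finset.sum_eq_zero fun ψ hψ => ?_
  rw [classInner_sum_left]
  refine Finset.sum_eq_zero fun φ hφ => ?_
  have hψ' : IsIrrChar K ψ := (irrChars_finite_holds K).mem_toFinset.mp hψ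
  have hφ' : IsIrrChar L φ := (irrChars_finite_holds L).mem_toFinset.mp hφ
  rw [classInner_smul_left, (prodBudget_isIrrChar_boxTimes hψ' hφ').classInner_eq hχ,
    if_neg (fun h => hne ⟨ψ, hψ', φ, hφ', h.symm⟩), mul_zero]

/-! ## (d) Membership in `J_K ⊠ J_L` splits -/

/-- `Σ_l φ(l) φ(l⁻¹) = |L| ⟨φ, φ⟩ = |L| ≠ 0` for an irreducible character `φ`. [folklore] -/
theorem prodBudget_sum_mul_inv_ne_zero {L : Type} [Group L] [Fintype L] {φ : L → ℂ}
    (hφ : IsIrrChar L φ) : ∑ l, φ l * φ l⁻¹ ≠ 0 := by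
  intro h0
  have h1 : classInner φ φ = 1 := by rw [hφ.classInner_eq hφ, if_pos rfl]
  rw [classInner_apply, h0, mul_zero] at h1
  exact zero_ne_one h1

/-- If `ψ ⊠ φ ∈ J_K ⊠ J_L` with `φ` irreducible then `ψ ∈ J_K`: the averaging map
`F ↦ (k ↦ Σ_l F (k, l) φ(l⁻¹))` sends `f ⊠ g` to a multiple of `f` and `ψ ⊠ φ` to `|L| · ψ`. [folklore] -/
theorem prodBudget_mem_left {K L : Type} [Group K] [Group L] [Fintype L]
    (JK : Submodule ℂ (K → ℂ)) (JL : Submodule ℂ (L → ℂ)) {ψ : K → ℂ} {φ : L → ℂ}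
    (hφ : IsIrrChar L φ)
    (h : (fun p : K × L => ψ p.1 * φ p.2) ∈
      Submodule.span ℂ {F : K × L → ℂ | ∃ f ∈ JK, ∃ g ∈ JL, F = fun p => f p.1 * g p.2}) :
    ψ ∈ JK := by
  let T : (K × L → ℂ) →ₗ[ℂ] (K → ℂ) :=
    { toFun := fun F k => ∑ l, F (k, l) * φ l⁻¹
      map_add' := fun F F' => by
        funext k
        simp only [Pi.add_apply, add_mul, Finset.sum_add_distrib]
      map_smul' := fun c F => by
        funext k
        simp only [Pi.smul_apply, smul_eq_mul, RingHom.id_apply, Finset.mul_sum, mul_assoc] }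
  have hTbox : ∀ (f : K → ℂ) (g : L → ℂ),
      T (fun p => f p.1 * g p.2) = (∑ l, g l * φ l⁻¹) • f := fun f g => by
    funext k
    simp only [T, LinearMap.coe_mk, AddHom.coe_mk, Pi.smul_apply, smul_eq_mul, Finset.sum_mul]
    exact Finset.sum_congr rfl fun l _ => by ring
  have hle : Submodule.span ℂ {F : K × L → ℂ | ∃ f ∈ JK, ∃ g ∈ JL, F = fun p => f p.1 * g p.2} ≤
      JK.comap T := by
    refine Submodule.span_le.mpr ?_
    rintro F ⟨f, hf, g, -, rfl⟩
    show T _ ∈ JK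
    rw [hTbox]
    exact JK.smul_mem _ hf
  have hmem : (∑ l, φ l * φ l⁻¹) • ψ ∈ JK := by
    rw [← hTbox]
    exact hle h
  exact (JK.smul_mem_iff (prodBudget_sum_mul_inv_ne_zero hφ)).mp hmem

/-- If `ψ ⊠ φ ∈ J_K ⊠ J_L` with `ψ` irreducible then `φ ∈ J_L` (average against `ψ(k⁻¹)`). [folklore] -/
theorem prodBudget_mem_right {K L : Type} [Group K] [Fintype K] [Group L]
    (JK : Submodule ℂ (K → ℂ)) (JL : Submodule ℂ (L → ℂ)) {ψ : K → ℂ} {φ : L → ℂ}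
    (hψ : IsIrrChar K ψ)
    (h : (fun p : K × L => ψ p.1 * φ p.2) ∈
      Submodule.span ℂ {F : K × L → ℂ | ∃ f ∈ JK, ∃ g ∈ JL, F = fun p => f p.1 * g p.2}) :
    φ ∈ JL := by
  let T : (K × L → ℂ) →ₗ[ℂ] (L → ℂ) :=
    { toFun := fun F l => ∑ k, F (k, l) * ψ k⁻¹
      map_add' := fun F F' => by
        funext l
        simp only [Pi.add_apply, add_mul, Finset.sum_add_distrib]
      map_smul' := fun c F => by
        funext l
        simp only [Pi.smul_apply, smul_eq_mul, RingHom.id_apply, Finset.mul_sum, mul_assoc] }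
  have hTbox : ∀ (f : K → ℂ) (g : L → ℂ),
      T (fun p => f p.1 * g p.2) = (∑ k, f k * ψ k⁻¹) • g := fun f g => by
    funext l
    simp only [T, LinearMap.coe_mk, AddHom.coe_mk, Pi.smul_apply, smul_eq_mul, Finset.sum_mul]
    exact Finset.sum_congr rfl fun k _ => by ring
  have hle : Submodule.span ℂ {F : K × L → ℂ | ∃ f ∈ JK, ∃ g ∈ JL, F = fun p => f p.1 * g p.2} ≤
      JL.comap T := by
    refine Submodule.span_le.mpr ?_
    rintro F ⟨f, -, g, hg, rfl⟩
    show T _ ∈ JL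
    rw [hTbox]
    exact JL.smul_mem _ hg
  have hmem : (∑ k, ψ k * ψ k⁻¹) • φ ∈ JL := by
    rw [← hTbox]
    exact hle h
  exact (JL.smul_mem_iff (prodBudget_sum_mul_inv_ne_zero hψ)).mp hmem

/-! ## (e) The graded budget inequality -/

/-- **Stub 2 — graded budget of a binary product.**  Every irreducible character of `K × L` is an
external product `ψ ⊠ φ` (`⟨ψ⊠φ, ψ⊠φ⟩ = 1`, completeness via the regular character), and
`ψ ⊠ φ ∈ J_K ⊠ J_L` forces `ψ ∈ J_K`, `φ ∈ J_L` (average against `φ(l⁻¹)`, resp. `ψ(k⁻¹)`); hence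
the graded budget of `J_K ⊠ J_L = span{(k,l) ↦ f k · g l}` is at most the product of the budgets
(the binary step of the graded CKSU wreath lift). [cite: CohnKleinbergSzegedyUmans2005, Thm. 7.1] -/
theorem stub_prodBudget (K L : Type) [Group K] [Fintype K] [DecidableEq K] [Group L] [Fintype L]
    [DecidableEq L] (JK : Submodule ℂ (K → ℂ)) (JL : Submodule ℂ (L → ℂ)) (s : ℝ) :
    (∑ᶠ χ ∈ irrChars (K × L) ∩ (Submodule.span ℂ {F : K × L → ℂ | ∃ f ∈ JK, ∃ g ∈ JL,
        F = fun p => f p.1 * g p.2} : Set (K × L → ℂ)), (χ 1).re ^ s) ≤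
      (∑ᶠ χ ∈ irrChars K ∩ (JK : Set (K → ℂ)), (χ 1).re ^ s) *
        (∑ᶠ χ ∈ irrChars L ∩ (JL : Set (L → ℂ)), (χ 1).re ^ s) := by
  classical
  have hA : (irrChars (K × L) ∩ (Submodule.span ℂ {F : K × L → ℂ | ∃ f ∈ JK, ∃ g ∈ JL,
      F = fun p => f p.1 * g p.2} : Set (K × L → ℂ))).Finite :=
    (irrChars_finite_holds (K × L)).subset Set.inter_subset_left
  have hB : (irrChars K ∩ (JK : Set (K → ℂ))).Finite :=
    (irrChars_finite_holds K).subset Set.inter_subset_left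
  have hC : (irrChars L ∩ (JL : Set (L → ℂ))).Finite :=
    (irrChars_finite_holds L).subset Set.inter_subset_left
  rw [finsum_mem_eq_finite_toFinset_sum _ hA, finsum_mem_eq_finite_toFinset_sum _ hB,
    finsum_mem_eq_finite_toFinset_sum _ hC]
  -- the pairing `(ψ, φ) ↦ ψ ⊠ φ` and its weights
  set box : (K → ℂ) × (L → ℂ) → (K × L → ℂ) := fun q p => q.1 p.1 * q.2 p.2 with hbox
  have hw : ∀ q ∈ hB.toFinset ×ˢ hC.toFinset,
      ((box q) 1).re ^ s = (q.1 1).re ^ s * (q.2 1).re ^ s := by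
    intro q hq
    rw [Finset.mem_product, hB.mem_toFinset, hC.mem_toFinset] at hq
    obtain ⟨dK, -, hdK⟩ := IsIrrChar.exists_apply_one hq.1.1
    obtain ⟨dL, -, hdL⟩ := IsIrrChar.exists_apply_one hq.2.1
    rw [hbox, hdK, hdL]
    simp only [Prod.fst_one, Prod.snd_one, hdK, hdL, ← Nat.cast_mul, Complex.natCast_re]
    rw [Nat.cast_mul, Real.mul_rpow (Nat.cast_nonneg _) (Nat.cast_nonneg _)]
  -- every `χ ∈ Irr(K × L) ∩ (J_K ⊠ J_L)` is `ψ ⊠ φ` with `ψ ∈ Irr K ∩ J_K`, `φ ∈ Irr L ∩ J_L`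
  have hsub : hA.toFinset ⊆ (hB.toFinset ×ˢ hC.toFinset).image box := by
    intro χ hχ
    rw [hA.mem_toFinset] at hχ
    obtain ⟨ψ, hψ, φ, hφ, rfl⟩ := prodBudget_exists_eq_boxTimes hχ.1
    refine Finset.mem_image.mpr ⟨(ψ, φ), ?_, rfl⟩
    rw [Finset.mem_product, hB.mem_toFinset, hC.mem_toFinset]
    exact ⟨⟨hψ, prodBudget_mem_left JK JL hφ hχ.2⟩, ⟨hφ, prodBudget_mem_right JK JL hψ hχ.2⟩⟩
  have hnn : ∀ χ ∈ (hB.toFinset ×ˢ hC.toFinset).image box, 0 ≤ (χ 1).re ^ s := by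
    intro χ hχ
    obtain ⟨q, hq, rfl⟩ := Finset.mem_image.mp hχ
    rw [Finset.mem_product, hB.mem_toFinset, hC.mem_toFinset] at hq
    exact Real.rpow_nonneg
      (prodBudget_re_apply_one_nonneg (prodBudget_isIrrChar_boxTimes hq.1.1 hq.2.1)) _
  calc ∑ χ ∈ hA.toFinset, (χ 1).re ^ s
      ≤ ∑ χ ∈ (hB.toFinset ×ˢ hC.toFinset).image box, (χ 1).re ^ s :=
        Finset.sum_le_sum_of_subset_of_nonneg hsub fun χ hχ _ => hnn χ hχ
    _ ≤ ∑ q ∈ hB.toFinset ×ˢ hC.toFinset, ((box q) 1).re ^ s :=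
        Finset.sum_image_le_of_nonneg hnn
    _ = ∑ q ∈ hB.toFinset ×ˢ hC.toFinset, (q.1 1).re ^ s * (q.2 1).re ^ s :=
        Finset.sum_congr rfl hw
    _ = (∑ χ ∈ hB.toFinset, (χ 1).re ^ s) * ∑ χ ∈ hC.toFinset, (χ 1).re ^ s := by
        rw [Finset.sum_product, Finset.sum_mul_sum]

end Summit.MatrixMultiplication.MatrixMultiplication.Theorems.GradedDesignFamily

end
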